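import Summits.AtomisticToContinuum.BoseEinsteinCondensation.Theorems.BlockLatticeFSumDirichletFloorShift

/-!
# Sub-cell modes BEYOND the Dirichlet box carry no occupation; dropping the last block layer (decomp-a2c hand-2 g8, groundwork for MF)

For MF «BoxMixedFloor» at block numbers `K ≡ 0 (mod 4)` the larger cell used in the zero-extension step has `K/2 + 2` super-blocks (an even
number, as F♭ requires) while MF sums over `K/2 + 1`; the extra layer of super-blocks lies beyond the (translated) Dirichlet box and its
modes have ZERO occupation.  This module proves exactly that and the re-indexing of the sum:

* `occupation_shiftMode_eq_zero` : for a Dirichlet state `Ψ` of `(0,L)^{3N}`, a sub-cell mode `u_m` of side `b > 0` back-translated by `a`,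
  if for some coordinate `k` the sub-cell starts beyond the box (`L ≤ b·m_k − a_k`) then `⟨u_m(· + a), γ_Ψ u_m(· + a)⟩ = 0`;
* `subMode_castSucc` : the mode depends only on the integer labels;
* `sum_subIdx_succ_eq_of_last_zero` : a sum over `SubIdx (K'+1)` whose terms vanish whenever some label is the last one equals the sum
  over `SubIdx K'` (labels embedded by `Fin.castSucc`).
`[folklore]`; no definitions, no `sorry`.
-/

noncomputable section

open MeasureTheory Set
open scoped ENNReal NNReal BigOperators ComplexConjugate

namespace Summit.AtomisticToContinuum.BoseEinsteinCondensation.Theorems.BlockLatticeFSumBoxModesVanish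

open Literature.MathematicalPhysics.QuantumManyBody.BoseGas

variable {N K' : ℕ} {L : ℝ}

/-- The sub-cell mode depends only on the integer values of its label: relabelling by `Fin.castSucc` does not change it. [folklore] -/
theorem subMode_castSucc (b : ℝ) (m : SubIdx K') :
    subMode b (fun k => Fin.castSucc (m k) : SubIdx (K' + 1)) = subMode b m := by
  funext x
  unfold subMode subOffset
  simp

/-- **Modes beyond the box are empty**: if the back-translated sub-cell `{x | x + a ∈ Q_m}` (side `b > 0`) starts at or beyond `L` in some
coordinate, its occupation in any Dirichlet state of `(0,L)^{3N}` vanishes (any side `b`). [folklore] -/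
theorem occupation_shiftMode_eq_zero (Ψ : TrialState N L) (b : ℝ) (a : Space) {K : ℕ} (m : SubIdx K)
    (hfar : ∃ k : Fin 3, L ≤ b * ((m k : ℕ) : ℝ) - a k) :
    occupation N (fun x => subMode b m (x + a)) Ψ.ψ = 0 := by
  obtain ⟨k, hk⟩ := hfar
  cases N with
  | zero => rfl
  | succ n =>
    simp only [occupation]
    have hzero : ∀ (Y : Config n) (x : Space), conj (subMode b m (x + a)) * Ψ.ψ (Matrix.vecCons x Y) = 0 := by
      intro Y x
      by_cases hx : x + a ∈ subCell b m
      · -- then `x_k ≥ b m_k − a_k ≥ L`, so `x ∉ box L` and `Ψ (x :: Y) = 0`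
        have hxk := ((mem_subCell.1 hx) k).1
        have hxL : L ≤ x k := by
          have : (x + a) k = x k + a k := rfl
          linarith
        have hnot : (Matrix.vecCons x Y : Config (n + 1)) ∉ boxN (n + 1) L := by
          intro hB
          have h0 := (hB 0 k).2
          simp at h0
          linarith
        rw [Ψ.eq_zero _ hnot, mul_zero]
      · rw [subMode_eq_indicator, Set.indicator_of_notMem hx, map_zero, zero_mul]
    have hint : ∀ Y : Config n, ∫ x, conj (subMode b m (x + a)) * Ψ.ψ (Matrix.vecCons x Y) = 0 := fun Y => by
      simp only [hzero, integral_zero]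
    simp only [hint, nnnorm_zero, ENNReal.coe_zero, ne_eq, OfNat.ofNat_ne_zero, not_false_eq_true, zero_pow,
      lintegral_zero, mul_zero]

/-- **Dropping the last layer**: if `f : SubIdx (K'+1) → ℝ≥0∞` vanishes on every label using the last index `K'` in some coordinate, then
`∑_{m : SubIdx (K'+1)} f m = ∑_{m' : SubIdx K'} f (castSucc ∘ m')`. [folklore] -/
theorem sum_subIdx_succ_eq_of_last_zero (f : SubIdx (K' + 1) → ℝ≥0∞)
    (hf : ∀ m : SubIdx (K' + 1), (∃ k, m k = Fin.last K') → f m = 0) :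
    ∑ m : SubIdx (K' + 1), f m = ∑ m' : SubIdx K', f (fun k => Fin.castSucc (m' k)) := by
  classical
  -- the embedding `m' ↦ castSucc ∘ m'`
  set ι : SubIdx K' → SubIdx (K' + 1) := fun m' k => Fin.castSucc (m' k) with hι
  have hinj : Function.Injective ι := by
    intro m₁ m₂ h
    funext k
    have := congrFun h k
    exact Fin.castSucc_injective _ this
  rw [← Finset.sum_image (f := f) (s := Finset.univ) (g := ι) fun x _ y _ h => hinj h]
  symm
  refine Finset.sum_subset (Finset.subset_univ _) fun m _ hm => hf m ?_
  -- a label not in the image uses the last index somewhere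
  by_contra hnone
  push Not at hnone
  apply hm
  refine Finset.mem_image.2 ⟨fun k => (m k).castPred (hnone k), Finset.mem_univ _, ?_⟩
  funext k
  simp [hι]

end Summit.AtomisticToContinuum.BoseEinsteinCondensation.Theorems.BlockLatticeFSumBoxModesVanish

end
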